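/-
Copyright (c) 2026. All rights reserved.
Released under Apache 2.0 license as described in the file LICENSE.
Authors: abc-iut cell, seat abc-iut-L4-t14 (gen 3; proof-only assembly: «objects of the geometric EA
mapping to ℍ/Γ̄» is id-rigid as soon as the profinite completion of the normaliser of Γ̄ in PSL₂(ℝ) is
slim — [AbsTopIII] Prop 4.2 (i) p.106 l.14–19 at the uniformised holomorphic model).
-/
import Literature.AnabelianGeometry.AbsoluteAnabelian.ArchimedeanHolFieldFunctorGeometricPSLFullyFaithful
import Literature.AnabelianGeometry.AbsoluteAnabelian.ArchimedeanHolFieldFunctorGeometricOverIdRigid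
import Literature.AnabelianGeometry.AbsoluteAnabelian.LocCategoryGroupModelSlim
import HarnessLib

/-!
# «Objects of `EA` mapping to `X = ℍ/Γ̄`» is id-rigid when `N_{PSL₂(ℝ)}(Γ̄)^` is slim (Prop 4.2 (i) assembled)

S. Mochizuki, *Topics in absolute anabelian geometry III*, proof of Prop 4.2 (i), kurims manuscript
p. 106 l. 14–19 (`paper:url-5493eb38cbb7`; bib key `MochizukiAbsTopIII2015`): "the full subcategory of
`EA` consisting of objects that map to `X` may, by Corollary 2.3, (i) …, be identified with the category
of finite étale R-localizations `Loc_R(X)` …. Thus, the id-rigidity of `EA` follows immediately from the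
slimness assertion of Lemma 4.3 below."

PROOF-ONLY assembly (no new notion) of abc-iut-L4-t14's gen-3 chain, for `X = ℍ/Γ̄` with
`Γ̄ ≤ PSL₂(ℝ)` acting freely and properly discontinuously on `ℍ` (finite-fibre hypothesis `hfin`):

* the identification: `HolRS.isEquivalence_lift_pslLocFunctor` (p439873) —
  `Loc(PSL₂(ℝ), Γ̄) ≌ {Y ∈ HolRS | Y maps to ℍ/Γ̄}`;
* the slimness step: `LocObj.isIdRigid_of_isSlimGroup_completion_normalizer` (p433906) — `Loc(N, Γ)` is
  id-rigid when `[N_N(Γ) : Γ] < ∞` and the profinite completion of `N_N(Γ)` is slim;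
* transport of id-rigidity along an equivalence across universes: abc-iut-L4-t12's
  `isIdRigid_iff_of_equivalence_univ`.

Result `HolRS.isIdRigid_mapsTo_pslQuotient_of_isSlimGroup`: **if `[N_{PSL₂(ℝ)}(Γ̄) : Γ̄] < ∞` and the
profinite completion of `N_{PSL₂(ℝ)}(Γ̄)` is slim, then the full subcategory of `HolRS` of objects mapping
to `ℍ/Γ̄` is id-rigid** — print's sentence with "Lemma 4.3" entering as the slimness of
`Π_{[X/Aut X]} = N_{PSL₂(ℝ)}(Γ̄)^` (campaign-L residual J2; NOT proved here), holomorphic morphisms and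
trivial orbi-structure only.  MODEL ≠ reconstruction; nothing here bears on [IUTchIII] Cor. 3.12;
typed ≠ proved.
-/

set_option autoImplicit false

noncomputable section

open scoped Manifold ContDiff Topology UpperHalfPlane MatrixGroups
open _root_.MulAction _root_.CategoryTheory
open Literature.AlgebraicGeometry.Frobenioids (IsSlimGroup)

namespace Literature.AnabelianGeometry.AbsoluteAnabelian

namespace HolRS

/-- **[AbsTopIII] Prop 4.2 (i), p.106 l.14–19, at the uniformised holomorphic model**: for
`Γ̄ ≤ PSL₂(ℝ)` acting freely and properly discontinuously on `ℍ` (finite-fibre hypothesis `hfin`), if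
`[N(Γ̄) : Γ̄] < ∞` and the profinite completion of the normaliser `N(Γ̄) = N_{PSL₂(ℝ)}(Γ̄)` is SLIM, then the
full subcategory of `HolRS` of objects mapping to `ℍ/Γ̄` is ID-RIGID («the id-rigidity … follows
immediately from the slimness assertion of Lemma 4.3», Lemma 4.3 read as slimness of
`Π_{[X/Aut X]} ≅ N(Γ̄)^`). [cite: MochizukiAbsTopIII2015, Proposition 4.2 (i) proof p.106] -/
theorem isIdRigid_mapsTo_pslQuotient_of_isSlimGroup (Γ : Subgroup PSL2R)
    [ProperlyDiscontinuousSMul Γ ℍ] [IsCancelSMul Γ ℍ]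
    (hfin : ∀ (g : PSL2R) (Λ₁ Λ₂ : LocObj Γ),
      (∀ x ∈ Λ₁.toSubgroup, g * x * g⁻¹ ∈ Λ₂.toSubgroup) →
      ((Literature.Geometry.Manifold.QuotientManifold.conjSubgroup g Λ₁.toSubgroup).subgroupOf
        Λ₂.toSubgroup).FiniteIndex)
    [(Γ.subgroupOf (Subgroup.normalizer (Γ : Set PSL2R))).FiniteIndex]
    (hslim : IsSlimGroup
      (ProfiniteGrp.ProfiniteCompletion.completion (GrpCat.of (Subgroup.normalizer (Γ : Set PSL2R))))) :
    IsIdRigid (ObjectProperty.FullSubcategory fun Y : HolRS => Nonempty (Y ⟶ pslQuotient Γ)) := by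
  haveI := isEquivalence_lift_pslLocFunctor Γ hfin
  exact (isIdRigid_iff_of_equivalence_univ
    (ObjectProperty.lift (fun Y : HolRS => Nonempty (Y ⟶ pslQuotient Γ)) (pslLocFunctor Γ hfin)
      (nonempty_hom_pslLocFunctor_obj Γ hfin)).asEquivalence).mp
    (LocObj.isIdRigid_of_isSlimGroup_completion_normalizer hslim)

/-- The same with the centraliser form of the hypothesis (abc-iut-L4-t14's
`LocObj.isIdRigid_of_completion_normalizer`: every element of `N(Γ̄)^` commuting with `η(Γ̄)` is
trivial) — strictly what the argument uses. [cite: MochizukiAbsTopIII2015, Proposition 4.2 (i) proof p.106] -/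
theorem isIdRigid_mapsTo_pslQuotient_of_centralizer (Γ : Subgroup PSL2R)
    [ProperlyDiscontinuousSMul Γ ℍ] [IsCancelSMul Γ ℍ]
    (hfin : ∀ (g : PSL2R) (Λ₁ Λ₂ : LocObj Γ),
      (∀ x ∈ Λ₁.toSubgroup, g * x * g⁻¹ ∈ Λ₂.toSubgroup) →
      ((Literature.Geometry.Manifold.QuotientManifold.conjSubgroup g Λ₁.toSubgroup).subgroupOf
        Λ₂.toSubgroup).FiniteIndex)
    [(Γ.subgroupOf (Subgroup.normalizer (Γ : Set PSL2R))).FiniteIndex]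
    (h : ∀ y : ProfiniteGrp.ProfiniteCompletion.completion
        (GrpCat.of (Subgroup.normalizer (Γ : Set PSL2R))),
      (∀ γ : Subgroup.normalizer (Γ : Set PSL2R), (γ : PSL2R) ∈ Γ →
        y * ProfiniteGrp.ProfiniteCompletion.etaFn _ γ =
          ProfiniteGrp.ProfiniteCompletion.etaFn _ γ * y) → y = 1) :
    IsIdRigid (ObjectProperty.FullSubcategory fun Y : HolRS => Nonempty (Y ⟶ pslQuotient Γ)) := by
  haveI := isEquivalence_lift_pslLocFunctor Γ hfin
  exact (isIdRigid_iff_of_equivalence_univ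
    (ObjectProperty.lift (fun Y : HolRS => Nonempty (Y ⟶ pslQuotient Γ)) (pslLocFunctor Γ hfin)
      (nonempty_hom_pslLocFunctor_obj Γ hfin)).asEquivalence).mp
    (LocObj.isIdRigid_of_completion_normalizer h)

end HolRS

end Literature.AnabelianGeometry.AbsoluteAnabelian

end
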